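import Summits.ResolutionOfSingularities.ResolutionOfSingularities.Theorems.RadicialJungCleanModelsF75cHolds
import Summits.ResolutionOfSingularities.ResolutionOfSingularities.Theorems.RadicialJungCleanModelsT2CleanModelsDimTwoOverField
import HarnessLib

/-!
# [stub `stub_stacks0BICLocus` of line `via-clean-models`] F-75c by name

Cell res-hironaka, seat res-inputs-p-f75c g0. The registered stub `stub_stacks0BICLocus` of the line `via-clean-models`
(`Cruxes/DescentPerfectToAll/Lines/via_clean_models.lean` :71; crux item stmt-ResolutionOfSingularities-15917 `CleanModels`) IS
the named fact F-75c at universe `0`; it is closed by the discharge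
`stacks0BIC_embeddedResolutionCurvesInSurfaces_locus_holds` (`Theorems/RadicialJungCleanModelsF75cHolds.lean`).
HONEST FRAMING: kernel bookkeeping of a printed theorem (Stacks 0BIC); nothing of [Hironaka2017]; not progress on resolution
in positive characteristic. AI-written; AI review is weaker than expert review.
-/

noncomputable section

set_option linter.dupNamespace false -- mandated namespace of this single-conjunct summit

namespace Summit.ResolutionOfSingularities.ResolutionOfSingularities.Theorems

/-- **Stub `stub_stacks0BICLocus`** (line `via-clean-models`): The Stacks Project, Lemma 54.15.6 (Tag 0BIC) with the locus of
the centres, at universe `0`. [cite: StacksProject, Tag 0BIC (Lemma 54.15.6)] -/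
theorem stub_stacks0BICLocus :
    Literature.AlgebraicGeometry.Resolution.Stacks0BIC_embeddedResolutionCurvesInSurfaces_locus.{0} :=
  stacks0BIC_embeddedResolutionCurvesInSurfaces_locus_holds.{0}

end Summit.ResolutionOfSingularities.ResolutionOfSingularities.Theorems

namespace Summit.ResolutionOfSingularities.ResolutionOfSingularities.Theorems.RadicialJung.CleanModels.T2

open CategoryTheory AlgebraicGeometry TopologicalSpace IsLocalRing
open Literature.AlgebraicGeometry.Resolution Literature.AlgebraicGeometry.Motives

/-- **`CleanModels` for `dim W = 2` over EVERY field of characteristic `p` — now UNCONDITIONAL**: the transfer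
`cleanModels_dimTwo_of_f75c` (✓ p578663) fed with the discharge of F-75c. OURS (the dim-2 slice of the crux `CleanModels`,
stmt-15917; the crux itself — all dimensions — is NOT proved here). [cite: Giraud1983, Thm. 2.4 and Prop. 1.5]
[cite: StacksProject, Tag 0BIC (Lemma 54.15.6)] -/
theorem cleanModels_dimTwo (p : ℕ) (hp : p.Prime)
    (k : Type) [Field k] [CharP k p] (W : Scheme.{0}) [IsIntegral W]
    (f : W ⟶ Spec (.of k)) [IsSeparated f] [LocallyOfFiniteType f] [QuasiCompact f]
    (hW : Scheme.IsRegular W) (L : Type) [Field L] [Algebra W.functionField L]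
    [IsPurelyInseparable W.functionField L] (hdeg : Module.finrank W.functionField L = p)
    (hdim₁ : ¬ topologicalKrullDim W ≤ 1) (hdim₂ : topologicalKrullDim W ≤ 2) :
    ∃ (V : Scheme.{0}) (π : V ⟶ W) (_ : IsIntegral V) (_ : IsDominant π),
      IsProper π ∧ IsBirational π ∧ Scheme.IsRegular V ∧ topologicalKrullDim V = 2 ∧
      (∀ v : V, (∃ (y : L) (g : W.functionField), y ∉ Set.range (algebraMap W.functionField L) ∧
        algebraMap W.functionField L g = y ^ p ∧
        ((∃ (d m : ℕ) (hmd : m ≤ d) (t : Fin d → V.presheaf.stalk v) (a : Fin m → ℕ),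
            Ideal.span (Set.range t) = maximalIdeal (V.presheaf.stalk v) ∧
            ringKrullDim (V.presheaf.stalk v) = (d : WithBot ℕ∞) ∧ 0 < m ∧ (∀ i, ¬ p ∣ a i) ∧
            RatFn.functionFieldMap π g = ∏ i : Fin m,
              (algebraMap (V.presheaf.stalk v) V.functionField (t (Fin.castLE hmd i))) ^ (a i)) ∨
          (∃ u₀ : V.presheaf.stalk v, IsUnit u₀ ∧
            RatFn.functionFieldMap π g = algebraMap (V.presheaf.stalk v) V.functionField u₀ ∧
            ((∀ c : V.presheaf.stalk v, u₀ - c ^ p ∉ maximalIdeal (V.presheaf.stalk v)) ∨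
              (∃ c : V.presheaf.stalk v, u₀ - c ^ p ∈ maximalIdeal (V.presheaf.stalk v) ∧
                u₀ - c ^ p ∉ maximalIdeal (V.presheaf.stalk v) ^ 2)))))) :=
  cleanModels_dimTwo_of_f75c
    Summit.ResolutionOfSingularities.ResolutionOfSingularities.Theorems.stacks0BIC_embeddedResolutionCurvesInSurfaces_locus_holds.{0}
    p hp k W f hW L hdeg hdim₁ hdim₂

end Summit.ResolutionOfSingularities.ResolutionOfSingularities.Theorems.RadicialJung.CleanModels.T2

end
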